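import Summits.BirchSwinnertonDyer.BirchSwinnertonDyer.Theorems.RamifiedSevenEllipticUnitsRelaxedSelmerSaturation
import Literature.NumberTheory.EllipticCurves.SubgroupSelmerProofs
import Literature.NumberTheory.EllipticCurves.SelmerProofs
import Literature.NumberTheory.EllipticCurves.KummerMap
import HarnessLib

set_option linter.dupNamespace false
set_option autoImplicit false

/-!
# Route `RamifiedSevenEllipticUnits` (rung K7r), value crux `EllipticUnitValueSevenOfGZK`
# (stmt-BirchSwinnertonDyer-19945; record twin 19705), line `rubin-formula-zp`, stub S_sat, half
# (S_sat-MW): **`Ш(E/K)[p^∞]` finite ⟹ every compact Selmer family is LEVELWISE a Kummer class of a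
# `K`-point** — the `Ш`-bridge from the tree's `Γ_K`-level objects (`sha`, `selmerGroup`,
# `torsionH1ToH1`, `kummerMapTorsion`) to the compact currency `compactSelmerOver (κ.layerSubgroup 0) p`
# (PROVED; `--supports 19945`)

Cell `bsd-cm`, seat `bsd-cm-k7r-c2` g5 (CLAIM on STATUS 2026-08-26T22:5xZ, the piece k8i-c2 g8's claim
of 22:20Z lists as NOT claimed: «the GZK → Ш-exponent bridge in H-currency»; here it is done at
`Γ_K`-level with EXISTING tree API only). HONEST FRAMING: cohomological plumbing + one descent step;
nothing about any curve's arithmetic is asserted; BSD is not proved; no named fact is minted; no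
definition is introduced (the two auxiliary maps are written as `resH1Hom` terms); `sorry`-free.

## The statement and the argument (Perrin-Riou 1987 §0 / Howard 2004 §1:
## `0 → E(K) ⊗ ℤ_p → S_p(E/K) → T_pШ(E/K) → 0`, the step «`T_pШ = 0` ⟹ `S_p` levelwise Kummer»)

Let `H = κ.layerSubgroup 0 = Γ_K` (bottom layer of a `ℤ_p`-tower; everything below only uses that `H`
contains every `σ ∈ Γ_K`), `res_m : H¹(Γ_K, E[m]) → H¹(H, E[m])` the (bijective,
`bijective_resH1Hom_subgroupIncl`) restriction, `j_m : H¹(H, E[m]) → H¹(H, E(K̄))` and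
`r : H¹(Γ_K, E(K̄)) → H¹(H, E(K̄))` the maps of the pairs `(id_H, E[m] ⊆ E(K̄))`, `(H ⊆ Γ_K, id)`.
(B1) `res_m` carries the tree's Kummer classes `kummerClassTorsion` to `kummerClassOver H`
(same cocycle `σ ↦ σQ − Q`). (B2) `res_m c` satisfies the `H`-level local Kummer condition at the
embedding `ι : K̄ → K̄_v` iff `c ∈ selmerLocalKerOfEmb` (functoriality + injectivity of the restriction to
`(Γ_v → Γ_K)⁻¹(H) = Γ_v`), hence (B3) `res_m c ∈ selmerTorsionOver H m ↔ c ∈ Sel^{(m)}(E/K)`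
(`conj_σ = id` on `H¹(Γ_K, ·)`). (B4) `j_{p^k} ∘ p_* = p · j_{p^{k+1}}` and `j_m ∘ res_m = r ∘ torsionH1ToH1`,
`r` injective. MAIN: for `x = (x_k) ∈ S_p(E/K)` and `c_k := res⁻¹ x_k ∈ Sel^{(p^k)}(E/K)`, the classes
`s_k := torsionH1ToH1 c_k` lie in `Ш(E/K)[p^k]` (the tree's PROVED fact `map_torsionH1ToH1_selmerGroup`),
and `y_k := j(x_k) = r(s_k)` satisfies `y_k = p · y_{k+1}`; if `p^e` kills `Ш(E/K)[p^∞]` then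
`y_k = p^e · y_{k+e} = r(p^e · s_{k+e}) = 0`, so `s_k = 0`, so `c_k` is in the range of the Kummer map
(`mem_range_kummerMapTorsion_of_torsionH1ToH1_eq_zero`, exactness of the Kummer sequence at
`H¹(K, E[p^k])`), i.e. **`x_k = kummerFamily P k` for a `K`-point `P`** (B1 + root independence). The
exponent `e` exists as soon as `Ш(E/K)[p^∞]` is finite (`exists_pow_kill_sha_of_finite`).
This is the input «levelwise Kummer» of the `p`-adic completion step «compatible + levelwise Kummer +
E(K) finitely generated ⟹ `x ∈ E(K) ⊗ ℤ_p` (`mordellWeilKummerSpan`)» (k8i-c2 g8's claimed part (C)),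
which together give (S_sat-MW) `S_p(E/K) ≤ E(K) ⊗ ℤ_p` from the finiteness of `Ш(E/K)[p^∞]` — at a 𝒞₇
frame a consequence of GZK for `W`, `W'` and the tree's odd-part quadratic descent of `Ш`.

## Main results (namespace `…Theorems.RamifiedSevenEllipticUnits.ShaFiniteLevelwiseKummer`)

* `resTop_kummerClassTorsion` (B1), `localResTorsionOverOfEmb_resTop` /
  `localResTorsionOverOfEmb_resTop_eq_zero_iff` (B2), `resTop_mem_selmerTorsionOver_iff` (B3),
  `pointsH1_reduceTorsionH1`, `pointsH1_resTop`, `resTop_points_injective`, `resTop_torsion_surjective`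
  (B4) — any subgroup `H ≤ Γ_K` containing every element (B3 over a number field).
* `mem_layerSubgroup_zero`; `exists_pow_kill_sha_of_finite` — `Finite Ш(E/K)[p^∞] ⟹ ∃ e, ∀ s ∈ Ш,
  p^k s = 0 → p^e s = 0`.
* **`exists_kummerFamily_apply_eq_of_sha_kill`** — the MAIN theorem at `κ.layerSubgroup 0` under the
  exponent hypothesis; **`exists_kummerFamily_apply_eq_of_finite_sha`** — under `Finite Ш(E/K)[p^∞]`.

References: B. Perrin-Riou, Bull. SMF 115 (1987) §0 pp. 401–402 [PerrinRiou1987BSMF]; B. Howard,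
Compos. Math. 140 (2004) §1 [Howard2004HeegnerKolyvagin]; J. H. Silverman, *AEC* (2009) VIII.§2,
X.§4 Thm. X.4.2 [SilvermanAEC2009]; J.-P. Serre, *Galois Cohomology* I.§2.4, II.§1.1
[SerreGaloisCohomology1997]; [BKNO] arXiv:2608.06879v1 §3.1.2, Lemma 7.1 (the stub this serves)
[BurungaleKobayashiNakamuraOta2026]; cell texts `Lines/rubin-formula-zp.md`, STATUS D117 (3)/(A2).
-/

noncomputable section

open scoped Classical

open WeierstrassCurve NumberField IsDedekindDomain Field
  Literature.NumberTheory.EllipticCurves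
  Literature.NumberTheory.GaloisRepresentations

universe u

namespace Summit.BirchSwinnertonDyer.BirchSwinnertonDyer.Theorems.RamifiedSevenEllipticUnits

namespace ShaFiniteLevelwiseKummer

/-! ## Part 1. Bridges between `H¹(Γ_K, ·)` and `H¹(H, ·)` for a subgroup `H` containing every element -/

section Bridges

variable {K : Type u} [Field K] (V : WeierstrassCurve K) (H : Subgroup (Field.absoluteGaloisGroup K))

/-- **(B1) Restriction carries the tree's `Γ_K`-level Kummer class to the `H`-level one**: for
`Q ∈ E(K̄)` with `m • Q` fixed, `res (kummerClassTorsion m Q) = kummerClassOver H m Q` — both are the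
class of the cocycle `σ ↦ σ • Q − Q`. [cite: SilvermanAEC2009, VIII.§2 (the Kummer map `δ`)] -/
theorem resTop_kummerClassTorsion (m : ℤ) (Q : geomPoints V)
    (hQ : m • Q ∈ MulAction.fixedPoints (Field.absoluteGaloisGroup K) (geomPoints V))
    (hQ' : ∀ σ ∈ H, σ • (m • Q) = m • Q) :
    resH1Hom (Literature.NumberTheory.EllipticCurves.subgroupIncl H)
        (AddMonoidHom.id (geomTorsion V m)) (fun _ _ ↦ rfl) (kummerClassTorsion V m Q hQ) =
      V.kummerClassOver H m Q hQ' := by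
  rw [kummerClassTorsion, WeierstrassCurve.kummerClassOver, resH1Hom_oneCocycleClass]
  congr 1

/-- **(B4a) `E[p^{k+1}] →(p·) E[p^k] ⊆ E(K̄)` is `p` times `E[p^{k+1}] ⊆ E(K̄)` on `H¹(H, ·)`**: with
`j_m : H¹(H, E[m]) → H¹(H, E(K̄))` the map of the pair `(id_H, E[m] ⊆ E(K̄))`,
`j_{p^k} ∘ p_* = p · j_{p^{k+1}}` (on cocycle representatives both are `σ ↦ p · f(σ)`; the global twin of
`RelaxedSelmerSaturation.torsionToPointsH1_reduceTorsionH1`, p466833).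
[cite: PerrinRiou1987BSMF, §0 p. 401 (the transition maps of `S_p(L)`)] -/
theorem pointsH1_reduceTorsionH1 (p k : ℕ) (c : V.torsionH1Over ((p : ℤ) ^ (k + 1)) H) :
    resH1Hom (ContinuousMonoidHom.id H) (geomTorsion V ((p : ℤ) ^ k)).subtype (fun _ _ ↦ rfl)
        (V.reduceTorsionH1 p k H c) =
      p • resH1Hom (ContinuousMonoidHom.id H) (geomTorsion V ((p : ℤ) ^ (k + 1))).subtype
        (fun _ _ ↦ rfl) c := by
  obtain ⟨f, rfl⟩ :=
    oneCocycleClass_surjective (discreteTopRep H (geomTorsion V ((p : ℤ) ^ (k + 1)))) c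
  rw [WeierstrassCurve.reduceTorsionH1, ← map_nsmul, ← Nat.cast_smul_eq_nsmul ℤ,
    ← oneCocycleClass_smul, resH1Hom_oneCocycleClass, resH1Hom_oneCocycleClass,
    resH1Hom_oneCocycleClass]
  congr 1

/-- **(B4b) `j_m ∘ res_m = r ∘ torsionH1ToH1`**: for `c ∈ H¹(Γ_K, E[m])`, pushing `res c` to
`H¹(H, E(K̄))` equals restricting `torsionH1ToH1 c ∈ H¹(Γ_K, E(K̄))` to `H` (both are the map of the
compatible pair `(H ⊆ Γ_K, E[m] ⊆ E(K̄))`). [cite: SerreGaloisCohomology1997, I.§2.4 (compatible pairs; functoriality)] -/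
theorem pointsH1_resTop (m : ℤ) (c : galH1Torsion V m) :
    resH1Hom (ContinuousMonoidHom.id H) (geomTorsion V m).subtype (fun _ _ ↦ rfl)
        (resH1Hom (Literature.NumberTheory.EllipticCurves.subgroupIncl H)
          (AddMonoidHom.id (geomTorsion V m)) (fun _ _ ↦ rfl) c) =
      resH1Hom (Literature.NumberTheory.EllipticCurves.subgroupIncl H)
        (AddMonoidHom.id (geomPoints V)) (fun _ _ ↦ rfl) (torsionH1ToH1 V m c) := by
  have e : torsionH1ToH1 V m =
      resH1Hom (ContinuousMonoidHom.id (Field.absoluteGaloisGroup K)) (geomTorsion V m).subtype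
        (fun _ _ ↦ rfl) := rfl
  rw [e, resH1Hom_resH1Hom, resH1Hom_resH1Hom]
  exact DFunLike.congr_fun (resH1Hom_congr (by ext; rfl) (by ext; rfl) _ _) c

/-- **`r : H¹(Γ_K, E(K̄)) → H¹(H, E(K̄))` is injective** (indeed bijective) for `H ∋` every `σ`
(`bijective_resH1Hom_subgroupIncl`). [cite: SerreGaloisCohomology1997, I.§2.4] -/
theorem resTop_points_injective (hH : ∀ σ : Field.absoluteGaloisGroup K, σ ∈ H) :
    Function.Injective (resH1Hom (Literature.NumberTheory.EllipticCurves.subgroupIncl H)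
      (AddMonoidHom.id (geomPoints V)) (fun _ _ ↦ rfl)) :=
  (bijective_resH1Hom_subgroupIncl (geomPoints V) H hH).injective

/-- **`res_m : H¹(Γ_K, E[m]) → H¹(H, E[m])` is surjective** for `H ∋` every `σ`
(`bijective_resH1Hom_subgroupIncl`). [cite: SerreGaloisCohomology1997, I.§2.4] -/
theorem resTop_torsion_surjective (hH : ∀ σ : Field.absoluteGaloisGroup K, σ ∈ H) (m : ℤ) :
    Function.Surjective (resH1Hom (Literature.NumberTheory.EllipticCurves.subgroupIncl H)
      (AddMonoidHom.id (geomTorsion V m)) (fun _ _ ↦ rfl)) :=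
  (bijective_resH1Hom_subgroupIncl (geomTorsion V m) H hH).surjective

variable {E : Type u} [Field E] [Algebra K E] (ι : AlgebraicClosure K →ₐ[K] AlgebraicClosure E)

/-- **(B2a) The `H`-level local restriction of `res c` is the restriction to `(Γ_E → Γ_K)⁻¹(H)` of the
`Γ_K`-level one**: `localResTorsionOverOfEmb m H ι (res c) = res_{H_E} (loc_ι c)` where
`loc_ι : H¹(Γ_K, E[m]) → H¹(Γ_E, E(K̄_E))` is the map of the pair `(resGalOfEmb ι, pointsMapOfEmb ι ∘ ⊆)`
(whose kernel is `selmerLocalKerOfEmb`). Functoriality (`resH1Hom_resH1Hom`); the torsion-coefficient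
twin of `localResOver_top_resH1Hom_subgroupIncl` (SubgroupSelmerProofs). [cite: SerreGaloisCohomology1997, I.§2.4 and II.§1.1] -/
theorem localResTorsionOverOfEmb_resTop (m : ℤ) (c : galH1Torsion V m) :
    V.localResTorsionOverOfEmb m H ι
        (resH1Hom (Literature.NumberTheory.EllipticCurves.subgroupIncl H)
          (AddMonoidHom.id (geomTorsion V m)) (fun _ _ ↦ rfl) c) =
      resH1Hom (Literature.NumberTheory.EllipticCurves.subgroupIncl (localSubgroupOfEmb H ι))
        (AddMonoidHom.id (localPoints V E)) (fun _ _ ↦ rfl)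
        (resH1Hom (resGalOfEmb ι) ((pointsMapOfEmb V ι).comp (geomTorsion V m).subtype)
          (fun σ P ↦ by
            simp only [AddMonoidHom.coe_comp, AddSubgroup.coe_subtype, Function.comp_apply,
              Literature.NumberTheory.EllipticCurves.AddSubgroup.torsionBy.coe_smul]
            exact pointsMapOfEmb_smul V ι σ P) c) := by
  rw [WeierstrassCurve.localResTorsionOverOfEmb, resH1Hom_resH1Hom, resH1Hom_resH1Hom]
  exact DFunLike.congr_fun (resH1Hom_congr (by ext; rfl) (by ext; rfl) _ _) c

/-- **(B2b) `res c` is Kummer at `ι` at the `H`-level iff `c ∈ selmerLocalKerOfEmb ι m`**: by (B2a)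
and the injectivity of the restriction to `(Γ_E → Γ_K)⁻¹(H) ∋` every `τ ∈ Γ_E`
(`resH1Hom_subgroupIncl_eq_zero_iff`). [cite: GreenbergLNM1716, §2 (local conditions via decomposition groups)]
[cite: SerreGaloisCohomology1997, II.§1.1] -/
theorem localResTorsionOverOfEmb_resTop_eq_zero_iff (hH : ∀ σ : Field.absoluteGaloisGroup K, σ ∈ H)
    (m : ℤ) (c : galH1Torsion V m) :
    V.localResTorsionOverOfEmb m H ι
        (resH1Hom (Literature.NumberTheory.EllipticCurves.subgroupIncl H)
          (AddMonoidHom.id (geomTorsion V m)) (fun _ _ ↦ rfl) c) = 0 ↔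
      c ∈ selmerLocalKerOfEmb V E ι m := by
  have hS : ∀ τ : Field.absoluteGaloisGroup E, τ ∈ localSubgroupOfEmb H ι := fun τ ↦
    (mem_localSubgroupOfEmb_iff H ι τ).2 (hH _)
  rw [localResTorsionOverOfEmb_resTop, resH1Hom_subgroupIncl_eq_zero_iff _ _ hS,
    selmerLocalKerOfEmb, resKer_eq_ker, AddMonoidHom.mem_ker]

end Bridges

/-! ## Part 2. The Selmer bridge over a number field: `res c ∈ Sel^{(m)}_H ↔ c ∈ Sel^{(m)}(E/K)` -/

section SelmerBridge

variable {K : Type u} [Field K] [NumberField K] (V : WeierstrassCurve K)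
  (H : Subgroup (Field.absoluteGaloisGroup K)) [H.Normal]

/-- **(B3) `res c ∈ selmerTorsionOver H m ↔ c ∈ selmerGroup V m`** for `H ∋` every `σ`: on `H¹(H, ·)`
every `conj_σ` is the identity (`conjH1_of_mem_holds`), so the `H`-level conditions are the local
Kummer conditions at the chosen embeddings, which (B2b) identifies with the `Γ_K`-level local kernels
`selmerLocalKer = selmerLocalKerOfEmb (closureEmb)` (`rfl`). The torsion-coefficient twin of
`resH1Hom_subgroupIncl_mem_selmerGroupOver_top_iff`. [cite: SilvermanAEC2009, X.§4 (Def. of the `m`-Selmer group)]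
[cite: GreenbergLNM1716, §2] -/
theorem resTop_mem_selmerTorsionOver_iff (hH : ∀ σ : Field.absoluteGaloisGroup K, σ ∈ H) (m : ℤ)
    (c : galH1Torsion V m) :
    resH1Hom (Literature.NumberTheory.EllipticCurves.subgroupIncl H)
        (AddMonoidHom.id (geomTorsion V m)) (fun _ _ ↦ rfl) c ∈ V.selmerTorsionOver H m ↔
      c ∈ selmerGroup V m := by
  have hconj : ∀ (σ : Field.absoluteGaloisGroup K) (y : V.torsionH1Over m H),
      conjH1 H (geomTorsion V m) σ y = y := fun σ y ↦ by
    rw [Literature.NumberTheory.EllipticCurves.conjH1_of_mem_holds H (geomTorsion V m) (hH σ),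
      AddMonoidHom.id_apply]
  simp only [WeierstrassCurve.selmerTorsionOver, AddSubgroup.mem_inf, AddSubgroup.mem_iInf,
    AddSubgroup.mem_comap, AddMonoidHom.mem_ker, hconj, mem_selmerGroup_iff,
    selmerLocalKer_eq_ofEmb, localResTorsionOverOfEmb_resTop_eq_zero_iff V H _ hH, forall_const]

end SelmerBridge

/-! ## Part 3. The main theorem: `Ш(E/K)[p^∞]` of bounded exponent ⟹ `S_p(E/K)` is levelwise Kummer -/

section Main

variable {K : Type u} [Field K] [NumberField K] (V : WeierstrassCurve K) (p : ℕ) [Fact p.Prime]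
  (κ : ZpExtension K p)

omit [NumberField K] in
/-- The bottom layer subgroup `κ.layerSubgroup 0 = Γ_K` contains every `σ` (`layerSubgroup_zero`).
[cite: GreenbergLNM1716, §1 (p. 60, `F_0 = F`)] -/
theorem mem_layerSubgroup_zero (σ : Field.absoluteGaloisGroup K) : σ ∈ κ.layerSubgroup 0 := by
  rw [ZpExtension.layerSubgroup_zero]; trivial

omit [Fact p.Prime] in
/-- **A finite `Ш(E/K)[p^∞]` has bounded exponent**: if the `p`-primary component of `Ш(E/K)` is finite,
there is `e` with `p^e · s = 0` for every `s ∈ Ш(E/K)` killed by some power of `p` (write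
`#Ш[p^∞] = p^a · u`, `p ∤ u`; the order of `s` is a `p`-power dividing `p^a · u`, hence divides `p^a`).
[cite: SilvermanAEC2009, X.§4 (Ш and its `p`-primary part; shape only)] -/
theorem exists_pow_kill_sha_of_finite (hp : p.Prime)
    [Finite (AddCommGroup.primaryComponent (↥V.sha) p)] :
    ∃ e : ℕ, ∀ s ∈ V.sha, ∀ k : ℕ, (p ^ k) • s = 0 → (p ^ e) • s = 0 := by
  obtain ⟨a, u, hu, hN⟩ := Nat.exists_eq_pow_mul_and_not_dvd
    (Nat.card_pos (α := AddCommGroup.primaryComponent (↥V.sha) p)).ne' p hp.ne_one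
  refine ⟨a, fun s hs k hk ↦ ?_⟩
  have hk' : (p ^ k) • (⟨s, hs⟩ : V.sha) = 0 := Subtype.ext (by simpa using hk)
  have hmem : (⟨s, hs⟩ : V.sha) ∈ AddCommGroup.primaryComponent (↥V.sha) p :=
    (AddCommGroup.mem_primaryComponent).2 ⟨k, hk'⟩
  set t : AddCommGroup.primaryComponent (↥V.sha) p := ⟨⟨s, hs⟩, hmem⟩ with ht
  have hkt : (p ^ k) • t = 0 := Subtype.ext hk'
  obtain ⟨n, -, hn⟩ := (Nat.dvd_prime_pow hp).1 (addOrderOf_dvd_iff_nsmul_eq_zero.2 hkt)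
  have hdvdN : p ^ n ∣ p ^ a * u := by
    rw [← hn, ← hN]; exact addOrderOf_dvd_natCard t
  have hdvd : p ^ n ∣ p ^ a :=
    (Nat.Coprime.pow_left n ((Nat.Prime.coprime_iff_not_dvd hp).2 hu)).dvd_of_dvd_mul_right hdvdN
  have hta : (p ^ a) • t = 0 := addOrderOf_dvd_iff_nsmul_eq_zero.1 (hn ▸ hdvd)
  have h1 : (p ^ a) • (⟨s, hs⟩ : V.sha) = 0 := congrArg Subtype.val hta
  simpa using congrArg Subtype.val h1

/-- **MAIN: if `p^e` kills `Ш(E/K)[p^∞]`, every compact Selmer family `x ∈ S_p(E/K)` is LEVELWISE a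
Kummer class of a `K`-point: `x_k = kummerFamily P_k k`.** Proof (module docstring): `c_k := res⁻¹ x_k`
lies in `Sel^{(p^k)}(E/K)` (B3), `s_k := torsionH1ToH1 c_k ∈ Ш(E/K)[p^k]`
(`map_torsionH1ToH1_selmerGroup_holds`), `y_k := j(x_k) = r(s_k)` (B4b) with `y_k = p · y_{k+1}` (B4a +
compatibility), so `y_k = p^e · y_{k+e} = r(p^e · s_{k+e}) = 0`, `s_k = 0` (`r` injective), `c_k` is a
Kummer class (`mem_range_kummerMapTorsion_of_torsionH1ToH1_eq_zero`) and `x_k = res c_k` is the level-`k`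
component of the Kummer family of that `K`-point (B1 + root independence). This is «`T_pШ(E/K) = 0`»
read levelwise: Perrin-Riou 1987 §0 / Howard 2004 §1, `0 → E(K) ⊗ ℤ_p → S_p(E/K) → T_pШ → 0`.
[cite: PerrinRiou1987BSMF, §0 pp. 401–402] [cite: Howard2004HeegnerKolyvagin, §1 (descent sequence for S_p(E/L))]
[cite: SilvermanAEC2009, VIII.§2 and Thm. X.4.2 (a)] -/
theorem exists_kummerFamily_apply_eq_of_sha_kill [V.IsElliptic] {e : ℕ}
    (hSha : ∀ s ∈ V.sha, ∀ k : ℕ, (p ^ k) • s = 0 → (p ^ e) • s = 0)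
    {x : V.torsionH1Pi p (κ.layerSubgroup 0)} (hx : x ∈ V.compactSelmerOver (κ.layerSubgroup 0) p)
    (k : ℕ) :
    ∃ P : V.fixedGeomPoints (κ.layerSubgroup 0), x k = V.kummerFamily p (κ.layerSubgroup 0) P k := by
  have hp : p.Prime := Fact.out
  have hH : ∀ σ : Field.absoluteGaloisGroup K, σ ∈ κ.layerSubgroup 0 := mem_layerSubgroup_zero p κ
  obtain ⟨hsel, hcomp⟩ := (V.mem_compactSelmerOver_iff (κ.layerSubgroup 0) p x).1 hx
  -- `c j := res⁻¹ (x j) ∈ Sel^{(p^j)}(E/K)`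
  choose c hc using fun j ↦ resTop_torsion_surjective V (κ.layerSubgroup 0) hH ((p : ℤ) ^ j) (x j)
  have hcSel : ∀ j, c j ∈ selmerGroup V ((p : ℤ) ^ j) := fun j ↦
    (resTop_mem_selmerTorsionOver_iff V (κ.layerSubgroup 0) hH _ (c j)).1 (by rw [hc]; exact hsel j)
  -- `s j := torsionH1ToH1 (c j) ∈ Ш ⊓ H¹[p^j]`
  have hs : ∀ j, torsionH1ToH1 V ((p : ℤ) ^ j) (c j) ∈
      V.sha ⊓ AddSubgroup.torsionBy V.galH1 ((p : ℤ) ^ j) := fun j ↦ by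
    rw [← V.map_torsionH1ToH1_selmerGroup_holds
      (pow_ne_zero j (Int.natCast_ne_zero.2 hp.ne_zero))]
    exact AddSubgroup.mem_map_of_mem _ (hcSel j)
  -- `y j := j_{p^j} (x j) ∈ H¹(H, E(K̄))`, `y j = p • y (j+1)`, `y j = r (s j)`
  let y : ℕ → discreteH1 (κ.layerSubgroup 0) (geomPoints V) := fun j ↦
    resH1Hom (ContinuousMonoidHom.id (κ.layerSubgroup 0)) (geomTorsion V ((p : ℤ) ^ j)).subtype
      (fun _ _ ↦ rfl) (x j)
  have hstep : ∀ j, y j = p • y (j + 1) := fun j ↦ by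
    simp only [y]
    rw [← hcomp j, pointsH1_reduceTorsionH1]
  have hyr : ∀ j, y j = resH1Hom (Literature.NumberTheory.EllipticCurves.subgroupIncl (κ.layerSubgroup 0))
      (AddMonoidHom.id (geomPoints V)) (fun _ _ ↦ rfl) (torsionH1ToH1 V ((p : ℤ) ^ j) (c j)) := fun j ↦ by
    simp only [y]
    rw [← hc j, pointsH1_resTop]
  have hy0 : y k = 0 := by
    rw [RelaxedSelmerSaturation.eq_pow_nsmul_of_step p y hstep k e, hyr (k + e), ← map_nsmul]
    obtain ⟨hsha, htor⟩ := AddSubgroup.mem_inf.1 (hs (k + e))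
    have hpk : (p ^ (k + e)) • torsionH1ToH1 V ((p : ℤ) ^ (k + e)) (c (k + e)) = 0 := by
      change ((p : ℤ) ^ (k + e)) • torsionH1ToH1 V ((p : ℤ) ^ (k + e)) (c (k + e)) = 0 at htor
      rw [← natCast_zsmul, Nat.cast_pow]
      exact htor
    rw [hSha _ hsha (k + e) hpk, map_zero]
  -- hence `s k = 0`, and `c k` is a Kummer class
  have hck : torsionH1ToH1 V ((p : ℤ) ^ k) (c k) = 0 := by
    apply resTop_points_injective V (κ.layerSubgroup 0) hH
    rw [← hyr k, hy0, map_zero]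
  have hpk : ((p : ℤ) ^ k) ≠ 0 := pow_ne_zero _ (Int.natCast_ne_zero.mpr hp.ne_zero)
  have hdiv : ∀ P : geomPoints V, ∃ Q : geomPoints V, ((p : ℤ) ^ k) • Q = P := fun P ↦
    V.zsmul_geomPoints_surjective_holds hpk P
  obtain ⟨P, hP⟩ := mem_range_kummerMapTorsion_of_torsionH1ToH1_eq_zero V ((p : ℤ) ^ k) hdiv (c k) hck
  obtain ⟨Q, hQ⟩ := hdiv (toGeomPoints V P)
  refine ⟨⟨toGeomPoints V P, (V.mem_fixedGeomPoints_iff _).2 fun σ _ ↦ smul_toGeomPoints V σ P⟩, ?_⟩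
  rw [V.isKummerFamilyOver_kummerFamily p (κ.layerSubgroup 0) _ k Q hQ, ← hc k, ← hP,
    kummerMapTorsion_apply, kummerMapTorsionFun_eq V _ hdiv P Q hQ, resTop_kummerClassTorsion]

/-- **MAIN, finite form: if `Ш(E/K)[p^∞]` is finite, every `x ∈ S_p(E/K)` is levelwise a Kummer class of
a `K`-point** (`exists_pow_kill_sha_of_finite` + the previous theorem). With Mordell–Weil (the tree's
`module_finite_point_holds`) and the `p`-adic completion of the Kummer image this is (S_sat-MW)
`S_p(E/K) ≤ E(K) ⊗ ℤ_p` of the line card — `T_pШ(E/K) = 0` in compact currency.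
[cite: PerrinRiou1987BSMF, §0 pp. 401–402] [cite: Howard2004HeegnerKolyvagin, §1 (descent sequence for S_p(E/L))] -/
theorem exists_kummerFamily_apply_eq_of_finite_sha [V.IsElliptic]
    [Finite (AddCommGroup.primaryComponent (↥V.sha) p)]
    {x : V.torsionH1Pi p (κ.layerSubgroup 0)} (hx : x ∈ V.compactSelmerOver (κ.layerSubgroup 0) p)
    (k : ℕ) :
    ∃ P : V.fixedGeomPoints (κ.layerSubgroup 0), x k = V.kummerFamily p (κ.layerSubgroup 0) P k := by
  obtain ⟨e, he⟩ := exists_pow_kill_sha_of_finite V p (Fact.out : p.Prime)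
  exact exists_kummerFamily_apply_eq_of_sha_kill V p κ he hx k

end Main

end ShaFiniteLevelwiseKummer

end Summit.BirchSwinnertonDyer.BirchSwinnertonDyer.Theorems.RamifiedSevenEllipticUnits

end
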